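import Literature.Barriers.Parity.SiegelZeroDichotomyProofs
import Literature.NumberTheory.Sieve.SingularSeriesPairProofs
import HarnessLib

/-!
# `SiegelZeroDichotomy` — the Tao–Teräväinen form of the dichotomy: Corollary 1.8 (i) vendored,
# and `SiegelZeroTwinPrimes` proved from it

Topic `Literature/Barriers/Parity`, second companion of the catalogue entry
`SiegelZeroDichotomy.lean` (`Literature.Barriers.Parity.SiegelZeroTwinPrimes :=
UnboundedSiegelZeros → TwinPrimeConjecture`, Heath-Brown's Siegel-zero dichotomy, D-0021), kept
separate so that the statement file and its first companion `SiegelZeroDichotomyProofs.lean` are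
unchanged. The statement file proves the record from the tree's Matomäki–Merikoski fact
(`SiegelZeroTwinPrimes_of_matomakiMerikoski`); this file vendors the theorem OF THE CITED SOURCE
that carries the dichotomy — Tao–Teräväinen's Corollary 1.8 (i), the pair Hardy–Littlewood
asymptotic on the scales attached to an exceptional zero — as the named fact
`TaoTeravainen2021_pairHL` (D-0014), and proves the record from it
(`SiegelZeroTwinPrimes_of_pairHL`). This is the first layer of the decomposition of a discharge
`SiegelZeroTwinPrimes_holds`: what remains is exactly a discharge of `TaoTeravainen2021_pairHL`
(or of `Literature.Barriers.Parity.MatomakiMerikoski2023_fixedShift`), i.e. a formalisation of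
Tao–Teräväinen §§5, 7, 8 for `k = 2`, `ℓ = 0` (Propositions 5.2, 7.2, 8.1: Selberg-sieve
approximant `Λ_Siegel = (χ ∗ log)ν`, its Type I truncation via Kloosterman-sum bounds, and the
Type I correlation), resting on Proposition 3.5 (tree: the specialised named fact
`Literature.NumberTheory.LFunctions.SiegelZero.TaoTeravainen2021_prop35`), Siegel's theorem (tree:
`Literature.NumberTheory.LFunctions.Siegel.siegel_theorem_primitive`, proved) and the Weil bound for
Kloosterman sums (tree: `Literature.NumberTheory.LFunctions.weil_kloosterman_bound`, named fact).

## What the source prints (arXiv:2109.06291, read on the page; arXiv page numbers)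

* p. 3, Definition 1.4: "A Siegel zero `β` is a real number associated to a primitive quadratic
  Dirichlet character `χ` of conductor `q_χ` such that `L(β,χ) = 0` and `β = 1 - 1/(η log q_χ)`
  for some `η ≥ 10` (which we call the quality of the zero)." — the tree's
  `Literature.Barriers.Parity.IsSiegelZero χ η`.
* p. 3, Conjecture 1.2 and (1.2)–(1.3): "`𝔼_{n ≤ x} Λ(n+h_1)⋯Λ(n+h_k) = 𝔖 + o(1)` … where the
  singular series `𝔖` is defined by the formula `𝔖 := ∏_p β_p`,
  `β_p := (1 - 1/p)^{-k} (1 - |{h_1,…,h_k} (mod p)|/p)`"; p. 2: "`𝔼_{n ∈ A} f(n) :=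
  (1/|A|) ∑_{n ∈ A} f(n)`", "`n` is understood to range over natural numbers". — `𝔖` is the
  tree's Hardy–Littlewood singular series `Literature.NumberTheory.Sieve.singularSeries {h₁, h₂}`
  (same Euler factors `(1 - ν_H(p)/p)(1 - 1/p)^{-k}`, `Literature.NumberTheory.Sieve.singularSeriesFactor`).
* p. 4, Corollary 1.8: "Suppose that one has a Siegel zero `β` with associated conductor `q_χ`
  and quality `η`. Let `0 < ε₀ < 1` be fixed. (i) For any distinct fixed natural numbers
  `h_1, h_2`, one has `𝔼_{n ≤ x} Λ(n+h_1)Λ(n+h_2) = 𝔖 + O(1/log^{1/20} η)` uniformly for all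
  `q_χ^{41/2+ε₀} ≤ x ≤ q_χ^{η^{1/2}}`, where `𝔖` is defined by (1.2)." (The case `k = 2`,
  `ℓ = 0` of Theorem 1.6.)
* p. 6, §2.1: "`X = O(Y)` to denote the bound `|X| ≤ CY` where `C` is a constant which is allowed
  to depend on the "fixed" quantities `k, ℓ, h_1, …, h_k, h'_1, …, h'_ℓ, ε₀`; we permit the
  constants to be ineffective"; "We will also assume that `η` is sufficiently large depending on
  the fixed quantities, since otherwise the claim follows from standard upper bound sieves".
  [cite: TaoTeravainen2021, Definition 1.4, Conjecture 1.2, Corollary 1.8 (i), §2.1]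

## Design choices

* As in the statement file, `𝔼_{n ≤ x}` is rendered for natural `x` as the average over
  `1 ≤ n ≤ x` (a specialisation of the real `x` of the source), shifts are natural numbers `≥ 1`
  (the source's `ℕ = {1, 2, …}`, §2.3), and `O(1/log^{1/20} η)` is `∃ C` placed after the
  quantities it may depend on (`h₁, h₂, ε₀`) and before the Siegel zero and `x`; the constant is
  ineffective as in print. Nothing is stated more strongly than printed.
* The reduction `SiegelZeroTwinPrimes_of_pairHL` uses the shifts `(h₁, h₂) = (1, 3)`
  (`𝔖({1, 3}) = 𝔖({0, 2}) = 2C₂ > 0`, `singularSeries_pair_one_three`, from the tree's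
  `Literature.NumberTheory.Sieve.singularSeries_pair_holds` and `twinPrimeConst_pos_holds`), the scale `x = q^{21}`
  inside the window for `ε₀ = 1/4`, `η ≥ 441`, and the statement file's elementary bound
  `pairSum_le_of_noTwinAbove` / `eventually_pairSumBound_le` (without twin primes above `n₀` the
  pair sum is `o(x)`).
-/

noncomputable section

open Filter Finset
open scoped ArithmeticFunction.vonMangoldt Topology

namespace Literature.Barriers.Parity

/-! ### Tao–Teräväinen 2022, Corollary 1.8 (i) -/

/-- `𝔼_{n ≤ x} Λ(n + h₁) Λ(n + h₂)`: the average over `1 ≤ n ≤ x` (`x ∈ ℕ`) of the pair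
von Mangoldt correlation with shifts `h₁, h₂`. [cite: TaoTeravainen2021, Conjecture 1.2] -/
def vonMangoldtPairAverage (h₁ h₂ : ℕ) (x : ℕ) : ℝ :=
  (∑ n ∈ Icc 1 x, Λ (n + h₁) * Λ (n + h₂)) / x

/-- **Tao–Teräväinen 2022, Corollary 1.8 (i)** (the pair Hardy–Littlewood asymptotic on the
scales attached to an exceptional zero; the case `k = 2`, `ℓ = 0` of their Theorem 1.6, which
strengthens Heath-Brown's Theorem 1.5 (i)), as printed: "Suppose that one has a Siegel zero `β`
with associated conductor `q_χ` and quality `η`. Let `0 < ε₀ < 1` be fixed. (i) For any distinct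
fixed natural numbers `h₁, h₂`, one has `𝔼_{n ≤ x} Λ(n+h₁)Λ(n+h₂) = 𝔖 + O(1/log^{1/20} η)`
uniformly for all `q_χ^{41/2+ε₀} ≤ x ≤ q_χ^{η^{1/2}}`, where `𝔖` is defined by (1.2)"
(`𝔖 = ∏_p (1 - 1/p)^{-2}(1 - |{h₁,h₂} mod p|/p)`, the tree's
`Literature.NumberTheory.Sieve.singularSeries {h₁, h₂}`); the implied constant may depend on
`h₁, h₂, ε₀` and is ineffective (§2.1). Rendered with shifts `≥ 1`, natural `x`, and a Siegel
zero in the sense of Definition 1.4 (`IsSiegelZero`). A NAMED FACT.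
[cite: TaoTeravainen2021, Corollary 1.8 (i) and §2.1] -/
def TaoTeravainen2021_pairHL : Prop :=
  ∀ h₁ h₂ : ℕ, 1 ≤ h₁ → 1 ≤ h₂ → h₁ ≠ h₂ → ∀ ε₀ : ℝ, 0 < ε₀ → ε₀ < 1 →
    ∃ C : ℝ, ∀ (q : ℕ) [NeZero q] (χ : DirichletCharacter ℂ q) (η : ℝ), IsSiegelZero χ η →
      ∀ x : ℕ, (q : ℝ) ^ ((41 : ℝ) / 2 + ε₀) ≤ x → (x : ℝ) ≤ (q : ℝ) ^ Real.sqrt η →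
        |vonMangoldtPairAverage h₁ h₂ x -
            Literature.NumberTheory.Sieve.singularSeries ({(h₁ : ℤ), (h₂ : ℤ)} : Finset ℤ)| ≤
          C / Real.log η ^ ((1 : ℝ) / 20)

/-! ### The singular series of the shifts `(1, 3)` -/

/-- `ν_{{1,3}}(p) = 2 = ν_{{0,2}}(p)` for `p > 2` (`1`, `3` are incongruent mod `p`). [folklore] -/
theorem tupleResidueCount_pair_one_three_of_two_lt {p : ℕ} (hp : 2 < p) :
    Literature.NumberTheory.Sieve.tupleResidueCount ({1, 3} : Finset ℤ) p = 2 := by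
  rw [Literature.NumberTheory.Sieve.tupleResidueCount_eq_card_of_lt_holds _ p]
  · rfl
  · intro a ha b hb
    simp only [Finset.mem_insert, Finset.mem_singleton] at ha hb
    rcases ha with rfl | rfl <;> rcases hb with rfl | rfl <;> (rw [abs_lt]; omega)

/-- The Euler factors of `𝔖({1, 3})` and `𝔖({0, 2})` agree at every prime (the singular series
is translation invariant). [folklore] -/
theorem singularSeriesFactor_pair_one_three {p : ℕ} (hp : p.Prime) :
    Literature.NumberTheory.Sieve.singularSeriesFactor ({1, 3} : Finset ℤ) p =
      Literature.NumberTheory.Sieve.singularSeriesFactor ({0, 2} : Finset ℤ) p := by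
  unfold Literature.NumberTheory.Sieve.singularSeriesFactor
  rcases hp.eq_two_or_odd' with rfl | hodd
  · rw [show Literature.NumberTheory.Sieve.tupleResidueCount ({1, 3} : Finset ℤ) 2 = 1 from by decide,
      show Literature.NumberTheory.Sieve.tupleResidueCount ({0, 2} : Finset ℤ) 2 = 1 from by decide]
    rfl
  · have hp2 : 2 < p :=
      lt_of_le_of_ne hp.two_le (fun h => by rw [← h] at hodd; exact (by decide : ¬ Odd 2) hodd)
    rw [tupleResidueCount_pair_one_three_of_two_lt hp2,
      Literature.NumberTheory.Sieve.tupleResidueCount_pair_of_two_lt hp2]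
    rfl

/-- `𝔖({1, 3}) = 2C₂`: the partial products of `𝔖({1, 3})` and `𝔖({0, 2})` coincide, and
`𝔖({0, 2}) = 2C₂` (tree: `Literature.NumberTheory.Sieve.singularSeries_pair_holds`). [folklore] -/
theorem singularSeries_pair_one_three :
    Literature.NumberTheory.Sieve.singularSeries ({1, 3} : Finset ℤ) =
      2 * Literature.NumberTheory.Sieve.twinPrimeConst := by
  have hpart : Literature.NumberTheory.Sieve.singularSeriesPartial ({1, 3} : Finset ℤ) =
      Literature.NumberTheory.Sieve.singularSeriesPartial ({0, 2} : Finset ℤ) := by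
    funext x
    unfold Literature.NumberTheory.Sieve.singularSeriesPartial
    exact Finset.prod_congr rfl fun p hp =>
      singularSeriesFactor_pair_one_three (Nat.prime_of_mem_primesLE hp)
  have h02 := Literature.NumberTheory.Sieve.singularSeries_pair_holds
  unfold Literature.NumberTheory.Sieve.singularSeries_pair at h02
  rw [← h02]
  unfold Literature.NumberTheory.Sieve.singularSeries
  rw [hpart]

/-! ### The record from Corollary 1.8 (i) -/

/-- Shifting the pair sum: `∑_{1 ≤ n ≤ x} Λ(n+1)Λ(n+3) ≤ ∑_{1 ≤ m ≤ x+1} Λ(m)Λ(m+2)`. [folklore] -/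
theorem pairSum_one_three_le (x : ℕ) :
    ∑ n ∈ Icc 1 x, Λ (n + 1) * Λ (n + 3) ≤ ∑ m ∈ Icc 1 (x + 1), Λ m * Λ (m + 2) := by
  have hIcc : Finset.Icc 1 (x + 1) = (Finset.range (x + 1)).image (· + 1) := by
    ext n
    simp only [Finset.mem_Icc, Finset.mem_image, Finset.mem_range]
    constructor
    · intro hn
      exact ⟨n - 1, by omega, by omega⟩
    · rintro ⟨m, hm, rfl⟩
      omega
  rw [hIcc, Finset.sum_image fun a _ b _ hab => by simpa using hab]
  have hsub : Finset.Icc 1 x ⊆ Finset.range (x + 1) := by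
    intro n hn
    rw [Finset.mem_Icc] at hn
    rw [Finset.mem_range]
    omega
  calc ∑ n ∈ Icc 1 x, Λ (n + 1) * Λ (n + 3)
      = ∑ n ∈ Icc 1 x, Λ (n + 1) * Λ (n + 1 + 2) := by
        refine Finset.sum_congr rfl fun n _ => ?_
        rw [show n + 1 + 2 = n + 3 by ring]
    _ ≤ ∑ n ∈ Finset.range (x + 1), Λ (n + 1) * Λ (n + 1 + 2) :=
        Finset.sum_le_sum_of_subset_of_nonneg hsub fun n _ _ =>
          mul_nonneg ArithmeticFunction.vonMangoldt_nonneg ArithmeticFunction.vonMangoldt_nonneg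

/-- **Heath-Brown's dichotomy, proved from Tao–Teräväinen's Corollary 1.8 (i)**: Siegel zeros of
unbounded quality at arbitrarily large conductors imply the twin prime conjecture. If there were
no twin primes above `n₀`, the pair sum `∑_{m ≤ X} Λ(m)Λ(m+2)` would be `o(X)`
(`pairSum_le_of_noTwinAbove`, `eventually_pairSumBound_le`); but at a Siegel zero of quality
`η ≥ 441` and conductor `q`, Corollary 1.8 (i) with `(h₁, h₂) = (1, 3)`, `ε₀ = 1/4`, at the scale
`x = q^{21} ∈ [q^{41/2+1/4}, q^{√η}]`, gives `𝔼_{n ≤ x} Λ(n+1)Λ(n+3) ≥ 𝔖({1,3}) - C/log^{1/20} η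
> C₂` for `η` large (`𝔖({1,3}) = 2C₂ > 0`). [cite: TaoTeravainen2021, Corollary 1.8 (i)] -/
theorem SiegelZeroTwinPrimes_of_pairHL (hTT : TaoTeravainen2021_pairHL) : SiegelZeroTwinPrimes := by
  intro hU
  by_contra hno
  -- no twin primes above `n₀`
  have hno' : ∃ n₀ : ℕ, ∀ p : ℕ, n₀ < p → ¬ (p.Prime ∧ (p + 2).Prime) := by
    unfold Literature.NumberTheory.Sieve.TwinPrimeConjecture at hno
    simp only [not_forall, not_exists, not_and] at hno
    obtain ⟨n₀, hn₀⟩ := hno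
    exact ⟨n₀, fun p hp h => hn₀ p hp h.1 h.2⟩
  obtain ⟨n₀, hn₀⟩ := hno'
  -- the constants
  set c : ℝ := Literature.NumberTheory.Sieve.twinPrimeConst with hc_def
  have hc : 0 < c := Literature.NumberTheory.Sieve.twinPrimeConst_pos_holds
  obtain ⟨C, hC⟩ := hTT 1 3 le_rfl (by norm_num) (by norm_num) (1 / 4) (by norm_num) (by norm_num)
  -- `C / log^{1/20} η < c` for `η ≥ η₁`
  have hlim : Tendsto (fun η : ℝ => C / Real.log η ^ ((1 : ℝ) / 20)) atTop (𝓝 0) :=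
    tendsto_const_nhds.div_atTop
      ((tendsto_rpow_atTop (by norm_num)).comp Real.tendsto_log_atTop)
  obtain ⟨η₁, hη₁⟩ := eventually_atTop.mp (hlim.eventually (gt_mem_nhds hc))
  -- the pair-sum bound is `≤ (c/2) X` for `X ≥ X₁`
  obtain ⟨X₁, hX₁⟩ := eventually_atTop.mp (eventually_pairSumBound_le n₀ (half_pos hc))
  -- a Siegel zero of quality `≥ max η₁ 441` at a conductor `≥ max ⌈X₁⌉₊ 2`
  obtain ⟨q, inst, χ, η, hq, hη, hS⟩ := hU (max η₁ 441) (max ⌈X₁⌉₊ 2)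
  have hη₁η : η₁ ≤ η := le_of_max_le_left hη
  have h441 : (441 : ℝ) ≤ η := le_of_max_le_right hη
  have hq2 : 2 ≤ q := le_of_max_le_right hq
  have hqX : ⌈X₁⌉₊ ≤ q := le_of_max_le_left hq
  have hq1' : (1 : ℝ) ≤ q := by exact_mod_cast (show 1 ≤ q by omega)
  -- the scale `x = q^{21}`
  set x : ℕ := q ^ 21 with hx_def
  have hxcast : (x : ℝ) = (q : ℝ) ^ (21 : ℝ) := by
    rw [hx_def, Nat.cast_pow, show (21 : ℝ) = ((21 : ℕ) : ℝ) by norm_num, Real.rpow_natCast]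
  have hx1 : 1 ≤ x := Nat.one_le_pow _ _ (by omega)
  have hxq : q ≤ x := by
    calc q = q ^ 1 := (pow_one q).symm
      _ ≤ q ^ 21 := Nat.pow_le_pow_right (by omega) (by norm_num)
  have hxpos : (0 : ℝ) < x := by exact_mod_cast (show 0 < x by omega)
  -- `x` lies in the window
  have hlow : (q : ℝ) ^ ((41 : ℝ) / 2 + 1 / 4) ≤ x := by
    rw [hxcast]
    exact Real.rpow_le_rpow_of_exponent_le hq1' (by norm_num)
  have hup : (x : ℝ) ≤ (q : ℝ) ^ Real.sqrt η := by
    rw [hxcast]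
    refine Real.rpow_le_rpow_of_exponent_le hq1' ?_
    calc (21 : ℝ) = Real.sqrt (21 ^ 2) := (Real.sqrt_sq (by norm_num)).symm
      _ ≤ Real.sqrt η := Real.sqrt_le_sqrt (by norm_num; linarith)
  -- Corollary 1.8 (i) at this scale
  have havg := hC q χ η hS x hlow hup
  rw [show (((1 : ℕ) : ℤ)) = 1 by norm_num, show (((3 : ℕ) : ℤ)) = 3 by norm_num,
    singularSeries_pair_one_three] at havg
  have hsmall : C / Real.log η ^ ((1 : ℝ) / 20) < c := hη₁ η hη₁η
  -- hence the pair sum with shifts `(1, 3)` exceeds `c x`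
  have hbig : c * x < ∑ n ∈ Icc 1 x, Λ (n + 1) * Λ (n + 3) := by
    have h1 : c < vonMangoldtPairAverage 1 3 x := by
      have := abs_sub_lt_iff.mp (lt_of_le_of_lt havg hsmall)
      rw [← hc_def] at this
      linarith [this.1, this.2]
    unfold vonMangoldtPairAverage at h1
    rwa [lt_div_iff₀ hxpos] at h1
  -- but without twin primes above `n₀` it is `≤ (c/2)(x+1) ≤ c x`
  have hX₁x : X₁ ≤ ((x + 1 : ℕ) : ℝ) := by
    have h1 : X₁ ≤ (⌈X₁⌉₊ : ℝ) := Nat.le_ceil X₁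
    have h2 : (⌈X₁⌉₊ : ℝ) ≤ q := by exact_mod_cast hqX
    have h3 : (q : ℝ) ≤ ((x + 1 : ℕ) : ℝ) := by exact_mod_cast (hxq.trans (Nat.le_succ x))
    linarith
  have hbound := hX₁ ((x + 1 : ℕ) : ℝ) hX₁x
  rw [Nat.floor_natCast] at hbound
  have hpair := (pairSum_le_of_noTwinAbove hn₀ (x + 1)).trans hbound
  have hshift := pairSum_one_three_le x
  have hx1' : (1 : ℝ) ≤ x := by exact_mod_cast hx1
  push_cast at hpair
  nlinarith

/-- The no-go for disproofs, modulo Tao–Teräväinen's Corollary 1.8 (i): if the twin prime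
conjecture fails, the quality of Siegel zeros is bounded at large conductors.
[cite: TaoTeravainen2021, Corollary 1.8 (i) and (1.4)] -/
theorem not_twinPrime_bounds_siegelZeros_of_pairHL (hTT : TaoTeravainen2021_pairHL)
    (hno : ¬ Literature.NumberTheory.Sieve.TwinPrimeConjecture) :
    ∃ η₀ : ℝ, ∃ q₀ : ℕ, ∀ (q : ℕ) [NeZero q] (χ : DirichletCharacter ℂ q) (η : ℝ),
      q₀ ≤ q → IsSiegelZero χ η → η < η₀ :=
  (SiegelZeroTwinPrimes_of_pairHL hTT).disproof_bounds_quality hno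

end Literature.Barriers.Parity
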